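import Summits.CriticalPhenomena.PercolationContinuityZ3.Theorems.PercNearOneGluingNoHeavyLowerTailCubicFourPointL1Cells
import Mathlib.Tactic.Ring
import Mathlib.Tactic.Linarith
import Mathlib.Tactic.Positivity
import HarnessLib

/-!
# `NoHeavyLowerTail` (stmt-CriticalPhenomena-4575) — (L1) on the coordinate face `supp(V1)`: an exact degree-4 certificate from the two SHK3⁺ induction hypotheses alone

Support file (prover prim-facecert, Engine-A client; `--supports stmt-CriticalPhenomena-4575`).  Pure algebra, no sorries, no named facts, no new definitions
(vocabulary: prim-l12-p2's `HybMasses.ofCells` / `HybMasses.L1` and `CubicThreePointStep.F` = SHK3⁺).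

This is the Lean replay of the first machine-found FACE-RESPECTING certificate of the facecert programme (package
run/shared/lean/prim/prim-l12/prim-facecert/facecert-bench-v1, certificate `certs/FC_suppV1_L1_D4_KM1_S10.json`, found by the face-reduced Handelman LP
at total degree 4 with a linear multiplier and reconstructed exactly; verifier B residual 0).

SETTING.  `supp(V1)` is the 9-dimensional coordinate face of the simplex of 4-point cell laws on which the five cells `a|by|c, a|bc|y, a|bcy, ay|bc, ac|by`
vanish ("`b` is never joined to `c` or to `y` except through `a`"); it CONTAINS the 5-dimensional tight variety `V1 = CUT:a:b|cy` on which (L1) vanishes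
identically (`HybMasses.L1_cells_cut_a_b_cy`, file `…CubicFourPointL1Face`), so (L1) is genuinely degenerate on this face.  Live cells:
`x₁=a|b|c|y, x₂=a|b|cy, x₅=ay|b|c, x₆=ac|b|y, x₇=ab|c|y, x₁₁=acy|b, x₁₂=ab|cy, x₁₃=aby|c, x₁₄=abc|y, x₁₅=abcy` (indices = cell order of `threeB₁_polarization`).
The laws of `(a,b,c)` before/after gluing `y` into `a` are `x⁰ = (x₁+x₂+x₅, x₇+x₁₂+x₁₃, x₆+x₁₁, 0, x₁₄+x₁₅)` and `x¹ = (x₁+x₅, x₇+x₁₃, x₂+x₆+x₁₁, 0, x₁₂+x₁₄+x₁₅)`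
(as `(q,u₁,u₂,u₃,t)`; `u₃ = 0` on this face).

RESULT (`L1_cells_suppV1_certificate`, a `ring` identity at total mass one):
    `M · L1 = M · F(x⁰) + (M − x₁₂) · F(x¹)`,   `M = 2x₁₅ + 2x₁₄ + x₁₃ + 2x₁₂ + x₁₁ + x₇ + x₆ + x₅ + x₂ + x₁`,
hence (`L1_cells_suppV1_nonneg`) on this face (L1) follows from the two SHK3⁺ instances `F(x⁰), F(x¹) ≥ 0` (tree theorems for realizable laws:
`ThreePointLB.sahiE3_pairSep_nonneg`) and nonnegative cells — NO Sahi-`C₃`/E3GRP input is needed on `supp(V1)` (contrast: on `supp(V3)` the machine certificate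
uses `E1` and two increasing-event `E₃` rows).  NOT here: the mirror face `supp(V2)` (apply `b ↔ c`), `supp(V3)`, (L2), the full simplex.
-/

namespace Summit.CriticalPhenomena.PercolationContinuityZ3.Theorems

namespace HybMasses

open CubicThreePointStep

variable {R : Type*} [CommRing R]

/-- **Exact certificate for (L1) on the coordinate face `supp(V1)`** (cells `a|by|c = a|bc|y = a|bcy = ay|bc = ac|by = 0`, total mass one):
`M·L1 = M·F(x⁰) + (M − x₁₂)·F(x¹)` with the linear multiplier `M = 2x₁₅+2x₁₄+x₁₃+2x₁₂+x₁₁+x₇+x₆+x₅+x₂+x₁`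
(machine-found by the face-reduced Handelman LP of the facecert package, degree 4; here re-proved by `ring`). -/
theorem L1_cells_suppV1_certificate (x₁ x₂ x₅ x₆ x₇ x₁₁ x₁₂ x₁₃ x₁₄ x₁₅ : R)
    (hσ : x₁ + x₂ + x₅ + x₆ + x₇ + x₁₁ + x₁₂ + x₁₃ + x₁₄ + x₁₅ = 1) :
    (2 * x₁₅ + 2 * x₁₄ + x₁₃ + 2 * x₁₂ + x₁₁ + x₇ + x₆ + x₅ + x₂ + x₁) * (ofCells x₁ x₂ 0 0 x₅ x₆ x₇ 0 0 0 x₁₁ x₁₂ x₁₃).L1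
      = (2 * x₁₅ + 2 * x₁₄ + x₁₃ + 2 * x₁₂ + x₁₁ + x₇ + x₆ + x₅ + x₂ + x₁) * F (x₁ + x₂ + x₅) (x₇ + x₁₂ + x₁₃) (x₆ + x₁₁) 0 (x₁₄ + x₁₅)
        + (2 * x₁₅ + 2 * x₁₄ + x₁₃ + x₁₂ + x₁₁ + x₇ + x₆ + x₅ + x₂ + x₁) * F (x₁ + x₅) (x₇ + x₁₃) (x₂ + x₆ + x₁₁) 0 (x₁₂ + x₁₄ + x₁₅) := by
  have h : x₁₅ = 1 - x₁ - x₂ - x₅ - x₆ - x₇ - x₁₁ - x₁₂ - x₁₃ - x₁₄ := by rw [← hσ]; ring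
  subst h
  simp only [ofCells, L1, E3h, F]
  ring

/-- **(L1) on `supp(V1)` from SHK3⁺ alone.**  If the live cells have total mass one, `x₁₂, x₁₄, x₁₅ ≥ 0` (the only sign hypotheses the multiplier needs) and the two SHK3⁺ instances
`F(x⁰) ≥ 0` (in `G∖e`) and `F(x¹) ≥ 0` (in `G/e`) hold, then `L1 ≥ 0` on the face `a|by|c = a|bc|y = a|bcy = ay|bc = ac|by = 0`. -/
theorem L1_cells_suppV1_nonneg {x₁ x₂ x₅ x₆ x₇ x₁₁ x₁₂ x₁₃ x₁₄ x₁₅ : ℝ}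
    (hσ : x₁ + x₂ + x₅ + x₆ + x₇ + x₁₁ + x₁₂ + x₁₃ + x₁₄ + x₁₅ = 1)
    (h₁₂ : 0 ≤ x₁₂) (h₁₄ : 0 ≤ x₁₄) (h₁₅ : 0 ≤ x₁₅)
    (hF0 : 0 ≤ F (x₁ + x₂ + x₅) (x₇ + x₁₂ + x₁₃) (x₆ + x₁₁) 0 (x₁₄ + x₁₅))
    (hF1 : 0 ≤ F (x₁ + x₅) (x₇ + x₁₃) (x₂ + x₆ + x₁₁) 0 (x₁₂ + x₁₄ + x₁₅)) :
    0 ≤ (ofCells x₁ x₂ 0 0 x₅ x₆ x₇ 0 0 0 x₁₁ x₁₂ x₁₃).L1 := by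
  have hid := L1_cells_suppV1_certificate x₁ x₂ x₅ x₆ x₇ x₁₁ x₁₂ x₁₃ x₁₄ x₁₅ hσ
  have hM : 0 < 2 * x₁₅ + 2 * x₁₄ + x₁₃ + 2 * x₁₂ + x₁₁ + x₇ + x₆ + x₅ + x₂ + x₁ := by linarith
  have hM' : 0 ≤ 2 * x₁₅ + 2 * x₁₄ + x₁₃ + x₁₂ + x₁₁ + x₇ + x₆ + x₅ + x₂ + x₁ := by linarith
  have hrhs : 0 ≤ (2 * x₁₅ + 2 * x₁₄ + x₁₃ + 2 * x₁₂ + x₁₁ + x₇ + x₆ + x₅ + x₂ + x₁) * (ofCells x₁ x₂ 0 0 x₅ x₆ x₇ 0 0 0 x₁₁ x₁₂ x₁₃).L1 := by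
    rw [hid]; exact add_nonneg (mul_nonneg hM.le hF0) (mul_nonneg hM' hF1)
  exact (mul_nonneg_iff_of_pos_left hM).mp hrhs

end HybMasses

end Summit.CriticalPhenomena.PercolationContinuityZ3.Theorems
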